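import Summits.BirchSwinnertonDyer.BirchSwinnertonDyer.Theorems.SignedBaseChangeTwistPairGreenbergProductDivisibilityStubFrameData
import Literature.NumberTheory.QuadraticFields.ImaginaryQuadraticPrescribedSplittingInert
import Mathlib.Data.Nat.ChineseRemainder
import Mathlib.FieldTheory.Finite.Basic
import HarnessLib

/-!
# K1 `TwistPairGreenbergProductDivisibility` (stmt-BirchSwinnertonDyer-20249), line `birth` v4, registered stub
# `stub_frameDataBCS`: K1's arithmetic frame WITH the base-change engine's splitting package exists
# (route SignedBaseChange; `--supports` 20249)

Reshape v4 of line `birth` (lead prover sbc-p1): the open half of K1 is weakened to the natural hypotheses of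
the thesis's lever — Burungale–Castella–Skinner 2025, Prop. 5.2.1 (base change of `g` to a real quadratic `F`,
definite datum over `F` with `n⁻ = 𝒪_F`), read at a supersingular `p`. Besides K1's own eighteen conditions
(landed: `SignedBaseChangeK1FrameData.stub_frameData`, p511764) Prop. 5.2.1 wants, for `K` and `F = ℚ(√d)`:
(Heeg) every `ℓ ∣ N` splits in `K`; (disc) `d_K` odd, `≠ −3`; (i) `p` inert in `F`; (ii) `D_F = d` odd with its
primes split in `K`; (iii) `ℓ ∣ N` inert in `F` if `ℓ ≡ −1 (mod p)`, split otherwise ((iv)–(v) big image over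
`M = FK` / `F(ζ_p)` follow from `Surj W p`; (vi) `F ≠ ℚ(√5)` at `p = 5` from (i)). By the decomposition law in
`ℚ(√d)` (`d ≡ 1 (mod 4)` square-free: an odd prime `ℓ ∤ d` splits iff `d` is a square mod `ℓ`, `2` splits iff
`d ≡ 1 (mod 8)`) the `F`-conditions are RESIDUE conditions on `d`, and THIS FILE proves the whole package
(`stub_frameDataBCS`, VERBATIM the registered signature) by choosing

* the twist FIRST: `d = ℓ₀` a prime `≡ 1 (mod 8)` with `ℓ₀ ≡ 1 (mod ℓ)` for the odd `ℓ ∣ N` with `p ∤ ℓ + 1`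
  and `ℓ₀` a non-residue mod `p` and mod the odd `ℓ ∣ N` with `p ∣ ℓ + 1` (`exists_prime_one_mod_eight_prescribed`:
  CRT + Dirichlet, the pattern of `Quadratic.exists_prime_prescribed_residues`);
* then `K = ℚ(√−q)`, `q ≡ 7 (mod 8)` prime beyond `N + p + ℓ₀`, with `2`, `p`, `ℓ₀` and every prime of `N` SPLIT
  (`Quadratic.exists_imaginaryQuadratic_forall_split`) — so (Heeg), (disc), (ii), `(N, d_K) = 1`, and the twist is
  ramified only at `ℓ₀ ∤ pN d_K`;
* the rest (places `v ≠ v̄`, `ι`, the (cyclotomic, anticyclotomic) generator pair, (irr_K) framed from (sur), the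
  newforms and the minimal model of the twist) from the landed §1–§5 lemmas of `SignedBaseChangeK1FrameData`.

Tree theorems only; closes nothing by itself (the open stub is `stub_productDivisibilityBCS`).
-/

-- D-0017: single-problem summit, the namespace repeats the problem name by design.
set_option linter.dupNamespace false
set_option autoImplicit false

noncomputable section

open scoped Classical
open NumberField IsDedekindDomain Field WeierstrassCurve
open Literature.NumberTheory.EllipticCurves Literature.NumberTheory.GaloisRepresentations
  Literature.NumberTheory.EllipticCurves.ModularForms
open Summit.BirchSwinnertonDyer.BirchSwinnertonDyer.Theorems.SignedBaseChangeK1FrameData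

namespace Summit.BirchSwinnertonDyer.BirchSwinnertonDyer.Theorems.SignedBaseChangeK1FrameDataBCS

/-! ## §1 CRT + Dirichlet: the twist prime -/

/-- An odd prime has a quadratic non-residue, as a natural number. -/
theorem exists_nat_not_isSquare_zmod {l : ℕ} (hl : l.Prime) (hl2 : l ≠ 2) :
    ∃ m : ℕ, ¬ IsSquare ((m : ℕ) : ZMod l) := by
  haveI : Fact l.Prime := ⟨hl⟩
  have hc : ringChar (ZMod l) ≠ 2 := by rw [ZMod.ringChar_zmod_n]; exact hl2
  obtain ⟨x, hx⟩ := FiniteField.exists_nonsquare hc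
  exact ⟨x.val, by rwa [ZMod.natCast_zmod_val]⟩

/-- **Dirichlet + CRT, real-quadratic twist version.** Let `A`, `B` be disjoint finite sets of ODD primes
and `n` a bound. There is a prime `r > n`, `r ∉ A ∪ B`, `r ≡ 1 (mod 8)`, with `r ≡ 1 (mod a)` for every
`a ∈ A` (so `r` is a non-zero square mod `a`) and `r` a quadratic NON-residue (in particular non-zero)
modulo every `b ∈ B`. Proof: pick a non-residue `m_b` mod each `b ∈ B`; the system `x ≡ 1 (mod 8)`,
`x ≡ 1 (mod a)`, `x ≡ m_b (mod b)` has a solution prime to `8 ∏ a ∏ b` (CRT), and Dirichlet's theorem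
gives a prime in that class beyond any bound. (Pattern of
`Quadratic.exists_prime_prescribed_residues`.) -/
theorem exists_prime_one_mod_eight_prescribed (A B : Finset ℕ) (hA : ∀ a ∈ A, a.Prime ∧ a ≠ 2)
    (hB : ∀ b ∈ B, b.Prime ∧ b ≠ 2) (hAB : Disjoint A B) (n : ℕ) :
    ∃ r : ℕ, r.Prime ∧ n < r ∧ r ∉ A ∧ r ∉ B ∧ r % 8 = 1 ∧
      (∀ a ∈ A, (r : ZMod a) = 1) ∧
      (∀ b ∈ B, (r : ZMod b) ≠ 0 ∧ ¬ IsSquare (r : ZMod b)) := by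
  classical
  -- non-residues at the odd primes
  have H : ∀ l : ℕ, ∃ m : ℕ, (l.Prime ∧ l ≠ 2) → ¬ IsSquare ((m : ℕ) : ZMod l) := by
    intro l
    by_cases h : l.Prime ∧ l ≠ 2
    · obtain ⟨m, hm⟩ := exists_nat_not_isSquare_zmod h.1 h.2
      exact ⟨m, fun _ => hm⟩
    · exact ⟨0, fun h' => (h h').elim⟩
  choose ns hns using H
  -- CRT data: index set `{2} ∪ A ∪ B`, modulus `8` at the index `2`
  set U : Finset ℕ := A ∪ B with hU
  set t : Finset ℕ := insert 2 U with ht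
  set s : ℕ → ℕ := fun i => if i = 2 then 8 else i with hs_def
  set a : ℕ → ℕ := fun i => if i = 2 then 1 else (if i ∈ A then 1 else ((ns i : ℕ) : ZMod i).val)
    with ha_def
  have hUprime : ∀ i ∈ U, i.Prime ∧ i ≠ 2 := by
    intro i hi
    rw [hU, Finset.mem_union] at hi
    rcases hi with h | h
    · exact hA i h
    · exact hB i h
  have h2U : (2 : ℕ) ∉ U := fun h => (hUprime 2 h).2 rfl
  have hs2 : s 2 = 8 := by rw [hs_def]; simp
  have hsU : ∀ i ∈ U, s i = i := by
    intro i hi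
    rw [hs_def]
    simp [(hUprime i hi).2]
  have hs0 : ∀ i ∈ t, s i ≠ 0 := by
    intro i hi
    rw [ht, Finset.mem_insert] at hi
    rcases hi with rfl | hi
    · rw [hs2]; norm_num
    · rw [hsU i hi]; exact (hUprime i hi).1.ne_zero
  have hpp : Set.Pairwise (↑t : Set ℕ) (Function.onFun Nat.Coprime s) := by
    intro i hi j hj hij
    rw [Finset.mem_coe, ht, Finset.mem_insert] at hi hj
    have h8 : ∀ k ∈ U, Nat.Coprime 8 k := by
      intro k hk
      have h2k : Nat.Coprime 2 k :=
        (Nat.coprime_primes Nat.prime_two (hUprime k hk).1).mpr (hUprime k hk).2.symm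
      have : Nat.Coprime (2 ^ 3) k := Nat.Coprime.pow_left 3 h2k
      simpa using this
    rcases hi with rfl | hi <;> rcases hj with rfl | hj
    · exact (hij rfl).elim
    · show Nat.Coprime (s 2) (s j)
      rw [hs2, hsU j hj]; exact h8 j hj
    · show Nat.Coprime (s i) (s 2)
      rw [hs2, hsU i hi]; exact (h8 i hi).symm
    · show Nat.Coprime (s i) (s j)
      rw [hsU i hi, hsU j hj]
      exact (Nat.coprime_primes (hUprime i hi).1 (hUprime j hj).1).mpr hij
  obtain ⟨k, hk⟩ := Nat.chineseRemainderOfFinset a s t hs0 hpp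
  set M : ℕ := ∏ i ∈ t, s i with hM
  have hM0 : M ≠ 0 := Finset.prod_ne_zero_iff.mpr hs0
  have h2t : (2 : ℕ) ∈ t := by rw [ht]; exact Finset.mem_insert_self _ _
  have hUt : ∀ i ∈ U, i ∈ t := fun i hi => by rw [ht]; exact Finset.mem_insert_of_mem hi
  have hk8 : k % 8 = 1 := by
    have := hk 2 h2t
    rw [hs2] at this
    rw [ha_def] at this
    simp only [if_true] at this
    rw [Nat.ModEq] at this
    omega
  -- residues of `k` at the odd primes
  have hkA : ∀ i ∈ U, i ∈ A → (k : ZMod i) = 1 := by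
    intro i hi hiA
    have hmod := hk i (hUt i hi)
    rw [hsU i hi] at hmod
    have hai : a i = 1 := by rw [ha_def]; simp [(hUprime i hi).2, hiA]
    rw [hai] at hmod
    have := (ZMod.natCast_eq_natCast_iff _ _ _).mpr hmod
    rw [this, Nat.cast_one]
  have hkB : ∀ i ∈ U, i ∈ B → (k : ZMod i) = ((ns i : ℕ) : ZMod i) := by
    intro i hi hiB
    have hiA : i ∉ A := fun h => Finset.disjoint_left.mp hAB h hiB
    have hmod := hk i (hUt i hi)
    rw [hsU i hi] at hmod
    have hai : a i = ((ns i : ℕ) : ZMod i).val := by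
      rw [ha_def]; simp [(hUprime i hi).2, hiA]
    rw [hai] at hmod
    haveI : NeZero i := ⟨(hUprime i hi).1.ne_zero⟩
    have := (ZMod.natCast_eq_natCast_iff _ _ _).mpr hmod
    rw [this, ZMod.natCast_zmod_val]
  have hkcop : Nat.Coprime k M := by
    rw [hM]
    refine Nat.Coprime.prod_right fun i hi => ?_
    rw [ht, Finset.mem_insert] at hi
    rcases hi with rfl | hi
    · rw [hs2]
      show Nat.gcd k 8 = 1
      rw [Nat.gcd_comm, Nat.gcd_rec, hk8]
      rfl
    · rw [hsU i hi]
      haveI : Fact i.Prime := ⟨(hUprime i hi).1⟩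
      refine Nat.Coprime.symm ((Nat.Prime.coprime_iff_not_dvd (hUprime i hi).1).mpr fun hdvd => ?_)
      have hk0 : (k : ZMod i) = 0 := (ZMod.natCast_eq_zero_iff k i).mpr hdvd
      have hi2 : i ∈ A ∨ i ∈ B := Finset.mem_union.mp (hU ▸ hi)
      rcases hi2 with hiA | hiB
      · rw [hkA i hi hiA] at hk0
        exact one_ne_zero hk0
      · rw [hkB i hi hiB] at hk0
        exact hns i (hUprime i hi) (by rw [hk0]; exact IsSquare.zero)
  -- Dirichlet
  obtain ⟨r, hrn, hr, hrmod⟩ := Nat.forall_exists_prime_gt_and_zmodEq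
    (max n ((A ∪ B).sup id)) (q := M) (a := (k : ℤ)) hM0 (Nat.isCoprime_iff_coprime.mpr hkcop)
  have hrAB : r ∉ A ∪ B := fun h => by
    have : r ≤ (A ∪ B).sup id := Finset.le_sup (f := id) h
    omega
  rw [Finset.mem_union, not_or] at hrAB
  -- transport the congruences to `r`
  have hr_s : ∀ i ∈ t, (r : ZMod (s i)) = (k : ZMod (s i)) := by
    intro i hi
    have hdvd : s i ∣ M := by rw [hM]; exact Finset.dvd_prod_of_mem s hi
    have := Literature.NumberTheory.QuadraticFields.Quadratic.intCast_zmod_eq_of_modEq_of_dvd hrmod hdvd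
    rwa [Int.cast_natCast, Int.cast_natCast] at this
  have hr8 : r % 8 = 1 := by
    have := hr_s 2 h2t
    rw [hs2] at this
    have h' := (ZMod.natCast_eq_natCast_iff _ _ _).mp this
    rw [Nat.ModEq] at h'
    rw [h', hk8]
  refine ⟨r, hr, lt_of_le_of_lt (le_max_left _ _) hrn, hrAB.1, hrAB.2, hr8, ?_, ?_⟩
  · intro a' haA
    have haU : a' ∈ U := by rw [hU, Finset.mem_union]; exact Or.inl haA
    have := hr_s a' (hUt a' haU)
    rw [hsU a' haU] at this
    rw [this, hkA a' haU haA]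
  · intro b hbB
    have hbU : b ∈ U := by rw [hU, Finset.mem_union]; exact Or.inr hbB
    have := hr_s b (hUt b hbU)
    rw [hsU b hbU] at this
    rw [this, hkB b hbU hbB]
    refine ⟨fun h0 => ?_, hns b (hUprime b hbU)⟩
    exact hns b (hUprime b hbU) (by rw [h0]; exact IsSquare.zero)

/-! ## §2 Assembly: the registered stub `stub_frameDataBCS` -/

/-- **`stub_frameDataBCS` of line `birth` v4 (crux K1, stmt-BirchSwinnertonDyer-20249), VERBATIM the registered
signature.** For every globally minimal `W/ℚ`, prime `p ≥ 5` with `ClassX7 W p` and `Surj W p`, granted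
modularity with parametrisation: K1's frame data exist together with the BCS 2025 Prop. 5.2.1 splitting
package — (Heeg) and `2` split in `K`, `d_K` odd `≠ −3`, `d ≡ 1 (mod 8)`, primes of `d` split in `K`, `d` a
non-residue mod `p`, and for odd `ℓ ∣ N`: `d` a non-zero square mod `ℓ` iff `p ∤ ℓ + 1`. -/
theorem stub_frameDataBCS : Literature.NumberTheory.EllipticCurves.ModularForms.nonempty_modularParametrizationData → ∀ (W : WeierstrassCurve ℚ) [W.IsElliptic] [W.IsGloballyMinimal] (p : ℕ) [Fact p.Prime], 5 ≤ p → Literature.NumberTheory.EllipticCurves.Rank1Residual.ClassX7 W p → Literature.NumberTheory.EllipticCurves.Rank1Residual.Surj W p → ∃ (K : Type) (_ : Field K) (_ : NumberField K) (ι : PadicAlgCl p ≃+* ℂ) (v vbar : IsDedekindDomain.HeightOneSpectrum (NumberField.RingOfIntegers K)) (κ₁ κ₂ : Literature.NumberTheory.EllipticCurves.ZpExtension K p) (γ₁ γ₂ : Field.absoluteGaloisGroup K) (_ : Fact (Literature.NumberTheory.EllipticCurves.ZpExtension.IsTopGeneratorPair κ₁ κ₂ γ₁ γ₂)) (_ :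 NeZero (NumberField.discr K).natAbs) (N : ℕ) (_ : NeZero N) (f : CuspForm (CongruenceSubgroup.Gamma0 N) 2) (d : ℤ) (W' : WeierstrassCurve ℚ) (_ : W'.IsElliptic) (_ : W'.IsGloballyMinimal) (C : WeierstrassCurve.VariableChange ℚ) (N' : ℕ) (_ : NeZero N') (f' : CuspForm (CongruenceSubgroup.Gamma0 N') 2), Literature.NumberTheory.EllipticCurves.ModularForms.IsNewformOf W f ∧ (N : ℤ) = W.conductorNorm ℤ ∧ Literature.NumberTheory.EllipticCurves.ModularForms.IsNewformOf W' f' ∧ (N' : ℤ) = W'.conductorNorm ℤ ∧ Squarefree d ∧ 1 < d ∧ (∀ q : ℕ, q.Prime → Literature.NumberTheory.EllipticCurves.BurungaleSkinnerTianWan2024.RamifiedInQuadratic d q → q ≠ p ∧ ¬ q ∣ N ∧ ¬ (q : ℤ) ∣ NumberField.discr K) ∧ C • W' = W.quadraticTwist (d : ℚ) ∧ Literature.NumberTheory.EllipticCurves.IsImaginaryQuadratic K ∧ ((Ideal.span {(p : ℤ)}).primesOver (NumberField.RingOfIntegers K)).ncard = 2 ∧ ((p : ℕ) : NumberField.RingOfIntegers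 K) ∈ v.asIdeal ∧ ((p : ℕ) : NumberField.RingOfIntegers K) ∈ vbar.asIdeal ∧ vbar ≠ v ∧ (∀ (w : NumberField.InfinitePlace K) (k : NumberField.RingOfIntegers K), k ∈ v.asIdeal ↔ ‖ι.symm (w.embedding (k : K))‖ < 1) ∧ IsCoprime (N : ℤ) (NumberField.discr K) ∧ (∀ ρ : Literature.NumberTheory.GaloisRepresentations.ModPGaloisRep K (ZMod p) 2, (W.baseChange K).IsTorsionGaloisRep p ρ → Literature.NumberTheory.GaloisRepresentations.FramedRep.IsAbsolutelyIrreducible ρ) ∧ κ₁.IsCyclotomic ∧ κ₂.IsAnticyclotomic ∧ (∀ ℓ : ℕ, ℓ.Prime → ℓ ∣ N → ((Ideal.span {(ℓ : ℤ)}).primesOver (NumberField.RingOfIntegers K)).ncard = 2) ∧ ((Ideal.span {(2 : ℤ)}).primesOver (NumberField.RingOfIntegers K)).ncard = 2 ∧ (Odd (NumberField.discr K) ∧ NumberField.discr K ≠ -3) ∧ d % 8 = 1 ∧ (∀ ℓ : ℕ, ℓ.Prime → (ℓ : ℤ) ∣ d → ((Ideal.span {(ℓ : ℤ)}).primesOver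 (NumberField.RingOfIntegers K)).ncard = 2) ∧ ¬ IsSquare ((d : ℤ) : ZMod p) ∧ (∀ ℓ : ℕ, ℓ.Prime → ℓ ∣ N → ℓ ≠ 2 → ((d : ℤ) : ZMod ℓ) ≠ 0 ∧ (IsSquare ((d : ℤ) : ZMod ℓ) ↔ ¬ p ∣ ℓ + 1)) := by
  intro hmodP W _ _ p _ hp hX hs
  have hpP : p.Prime := Fact.out
  have hp2 : p ≠ 2 := by omega
  -- the newform of `W`; `p ∤ N` (good reduction at `p`)
  haveI hN0 : NeZero (W.conductorNorm ℤ) := ⟨(WeierstrassCurve.conductorNorm_pos_holds W).ne'⟩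
  obtain ⟨D⟩ := hmodP W
  set N : ℕ := W.conductorNorm ℤ with hNdef
  have hpN : ¬ p ∣ N := not_dvd_conductorNorm_of_hasGoodReductionAtPrime W hX.1.1
  -- §1 the twist prime `ℓ`: residues prescribed at `p` and at the odd primes of `N`
  set A : Finset ℕ := (N.primeFactors.erase 2).filter (fun ℓ ↦ ¬ p ∣ ℓ + 1) with hAdef
  set B : Finset ℕ := insert p ((N.primeFactors.erase 2).filter (fun ℓ ↦ p ∣ ℓ + 1)) with hBdef
  have hmemE : ∀ ℓ ∈ N.primeFactors.erase 2, ℓ.Prime ∧ ℓ ≠ 2 ∧ ℓ ∣ N := fun ℓ hℓ ↦ by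
    rw [Finset.mem_erase, Nat.mem_primeFactors] at hℓ
    exact ⟨hℓ.2.1, hℓ.1, hℓ.2.2.1⟩
  have hA : ∀ a ∈ A, a.Prime ∧ a ≠ 2 := fun a ha ↦ by
    rw [hAdef, Finset.mem_filter] at ha
    exact ⟨(hmemE a ha.1).1, (hmemE a ha.1).2.1⟩
  have hB : ∀ b ∈ B, b.Prime ∧ b ≠ 2 := fun b hb ↦ by
    rw [hBdef, Finset.mem_insert] at hb
    rcases hb with rfl | hb
    · exact ⟨hpP, hp2⟩
    · rw [Finset.mem_filter] at hb
      exact ⟨(hmemE b hb.1).1, (hmemE b hb.1).2.1⟩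
  have hAB : Disjoint A B := by
    rw [Finset.disjoint_left]
    intro a haA haB
    rw [hAdef, Finset.mem_filter] at haA
    rw [hBdef, Finset.mem_insert] at haB
    rcases haB with rfl | haB
    · exact hpN (hmemE _ haA.1).2.2
    · rw [Finset.mem_filter] at haB
      exact haA.2 haB.2
  obtain ⟨ℓ, hℓ, hℓgt, -, -, hℓ8, hℓA, hℓB⟩ := exists_prime_one_mod_eight_prescribed A B hA hB hAB (N + p)
  have hℓ4 : ℓ ≡ 1 [MOD 4] := by unfold Nat.ModEq; omega
  -- the field: `2`, `p`, `ℓ` and the primes of `N` split, `d_K = -q` with `q > N + p + ℓ`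
  obtain ⟨K, _, _, q, h2K, htc, hq, hnq, -, hq8, hdisc, hsplitT, -⟩ :=
    Literature.NumberTheory.QuadraticFields.Quadratic.exists_imaginaryQuadratic_forall_split
      (insert 2 (insert p (insert ℓ N.primeFactors))) (N + p + ℓ)
  have hK : IsImaginaryQuadratic K := ⟨h2K, htc⟩
  have hTN : ∀ l : ℕ, l.Prime → l ∣ N →
      ((Ideal.span {(l : ℤ)}).primesOver (𝓞 K)).ncard = 2 := fun l hl hlN ↦
    hsplitT l (by simp [Nat.mem_primeFactors, hl, hlN, hN0.out]) hl
  have hsplit : ((Ideal.span {(p : ℤ)}).primesOver (𝓞 K)).ncard = 2 := hsplitT p (by simp) hpP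
  have hsplitℓ : ((Ideal.span {(ℓ : ℤ)}).primesOver (𝓞 K)).ncard = 2 := hsplitT ℓ (by simp) hℓ
  have hsplit2 : ((Ideal.span {(2 : ℤ)}).primesOver (𝓞 K)).ncard = 2 := by
    exact_mod_cast hsplitT 2 (by simp) Nat.prime_two
  -- places above `p`, embedding datum, tower
  obtain ⟨v, vbar, hv, hvbar, hne⟩ := exists_pair_of_ncard_primesOver_eq_two hpP hsplit
  obtain ⟨ι, hι⟩ := exists_iota hK v hv
  obtain ⟨κ₁, κ₂, γ₁, γ₂, hpair, hcyc, hanti⟩ :=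
    exists_isTopGeneratorPair_isCyclotomic_isAnticyclotomic (p := p) hK hp2
  haveI : Fact (ZpExtension.IsTopGeneratorPair κ₁ κ₂ γ₁ γ₂) := ⟨hpair⟩
  haveI : NeZero (NumberField.discr K).natAbs :=
    ⟨by rw [hdisc, Int.natAbs_neg, Int.natAbs_natCast]; exact hq.ne_zero⟩
  -- the twist `W^{(ℓ)}` and its minimal model
  have hℓ0 : ((ℓ : ℤ) : ℚ) ≠ 0 := by exact_mod_cast hℓ.ne_zero
  haveI := W.isElliptic_quadraticTwist hℓ0
  obtain ⟨C₀, hC₀⟩ := WeierstrassCurve.hasGlobalMinimalModel_rat_holds (W.quadraticTwist ((ℓ : ℤ) : ℚ))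
  haveI : (C₀ • W.quadraticTwist ((ℓ : ℤ) : ℚ)).IsGloballyMinimal := hC₀
  haveI hN0' : NeZero ((C₀ • W.quadraticTwist ((ℓ : ℤ) : ℚ)).conductorNorm ℤ) :=
    ⟨(WeierstrassCurve.conductorNorm_pos_holds _).ne'⟩
  obtain ⟨D'⟩ := hmodP (C₀ • W.quadraticTwist ((ℓ : ℤ) : ℚ))
  refine ⟨K, inferInstance, inferInstance, ι, v, vbar, κ₁, κ₂, γ₁, γ₂, inferInstance, inferInstance, N,
    inferInstance, D.f, (ℓ : ℤ), C₀ • W.quadraticTwist ((ℓ : ℤ) : ℚ), inferInstance, hC₀, C₀⁻¹,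
    (C₀ • W.quadraticTwist ((ℓ : ℤ) : ℚ)).conductorNorm ℤ, inferInstance, D'.f, D.isNewformOf, rfl,
    D'.isNewformOf, rfl, ?_, ?_, ?_, inv_smul_smul C₀ _, hK, hsplit, hv, hvbar, hne, hι, ?_, ?_, hcyc, hanti,
    hTN, hsplit2, ?_, ?_, ?_, ?_, ?_⟩
  · -- `ℓ` square-free
    exact Int.squarefree_natCast.mpr hℓ.squarefree
  · -- `1 < ℓ`
    exact_mod_cast hℓ.one_lt
  · -- ramified in `ℚ(√ℓ)` only at `ℓ`, and `ℓ ∤ p N d_K`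
    intro q' hq' hram
    obtain rfl := eq_of_ramifiedInQuadratic hℓ hℓ4 hq' hram
    refine ⟨by omega, fun h ↦ ?_, fun h ↦ ?_⟩
    · exact absurd (Nat.le_of_dvd (Nat.pos_of_ne_zero hN0.out) h) (by omega)
    · rw [hdisc, Int.dvd_neg, Int.natCast_dvd_natCast, Nat.prime_dvd_prime_iff_eq hq' hq] at h
      omega
  · -- `(N, d_K) = 1`
    rw [hdisc]
    exact isCoprime_of_lt hq hN0.out (by omega)
  · -- (irr_K), framed
    exact fun ρ hρ ↦ irrK_framed_of_surj W p hp2 hs K hK.1 ρ hρ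
  · -- (disc): `d_K = -q` odd and `≠ -3`
    refine ⟨?_, ?_⟩
    · rw [hdisc, Int.odd_iff]; omega
    · rw [hdisc]; omega
  · -- `d ≡ 1 (mod 8)`
    omega
  · -- the primes of `d = ℓ` split in `K`
    intro l hl hdvd
    obtain rfl : l = ℓ := (Nat.prime_dvd_prime_iff_eq hl hℓ).mp (Int.natCast_dvd_natCast.mp hdvd)
    exact hsplitℓ
  · -- `d` is a non-residue mod `p` (`p` inert in `ℚ(√d)`)
    rw [Int.cast_natCast]
    exact (hℓB p (by rw [hBdef]; exact Finset.mem_insert_self _ _)).2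
  · -- odd `ℓ' ∣ N`: `d` a non-zero square mod `ℓ'` iff `p ∤ ℓ' + 1`
    intro l hl hlN hl2
    haveI : Fact l.Prime := ⟨hl⟩
    have hlE : l ∈ N.primeFactors.erase 2 := by
      rw [Finset.mem_erase, Nat.mem_primeFactors]; exact ⟨hl2, hl, hlN, hN0.out⟩
    rw [Int.cast_natCast]
    by_cases hpl : p ∣ l + 1
    · have hlB : l ∈ B := by
        rw [hBdef, Finset.mem_insert, Finset.mem_filter]; exact Or.inr ⟨hlE, hpl⟩
      obtain ⟨hne0, hnsq⟩ := hℓB l hlB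
      exact ⟨hne0, iff_of_false hnsq (not_not.mpr hpl)⟩
    · have hlA : l ∈ A := by rw [hAdef, Finset.mem_filter]; exact ⟨hlE, hpl⟩
      rw [hℓA l hlA]
      exact ⟨one_ne_zero, iff_of_true ⟨1, (mul_one 1).symm⟩ hpl⟩

end Summit.BirchSwinnertonDyer.BirchSwinnertonDyer.Theorems.SignedBaseChangeK1FrameDataBCS

end
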